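import Summits.Schanuel.Schanuel.Theorems.ZilberEacDensityLiftRotund
import Literature.ModelTheory.Zilber.EACDensityOscillatory
import HarnessLib

/-!
# The density lift: one rung up gives Zariski density; `Fib(3,2)` IS the free density question

Zilber's Exponential-Algebraic Closedness, case ladder (host summit Schanuel, cell `pub-schanuel`,
seat 2, gen 6).  The DENSITY LIFT `W_e(W) = {w ∈ W, y_last = x_last · e(w)}` of `ZilberEacDensityLift*`
carries every `W ⊆ ℂⁿ × ℂⁿ` with the binders of the cell `ECCell n d` of Zilber's conjecture, and
every `e ∉ I(W)`, to a member of the cell `ECCell (n+1) (d+1)` (`ecCell_binders_liftVar`: irreducible,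
meets the torus, ROTUND, additively and multiplicatively free, `dim` and `addProjDim` raised by one),
whose base has period `e_last` and whose fibre dimension is `dim W`; an exponential point
`(s, x; e^s, e^x)` of the lift is an exponential point `s` of `W` with `e(s) = e^x / x ≠ 0`.

This is Mantova–Masser's density trick (PLMS 2024, §1 p. 5: "if `G` … does not vanish on `𝒱`, we
may apply [BM2017] to the variety … defined by the equations of `𝒱` together with `G = X̂_{n+1}`")
and Aslanyan–Gallinaro's Remark 3.5 (arXiv:2409.12860: Exponential Closedness gives a Zariski dense
set of exponential points, via `y_{n+1} = F`; "it is not hard to show that if `V` is free and rotund,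
then `V₁` is as well"), TWISTED by the free coordinate — `y_{n+1} = x_{n+1} · F` instead of
`y_{n+1} = F` — so that multiplicative freeness and rotundity are kernel theorems for every `F`.

Consequences (all unconditional implications between statements that are OPEN in the tree):
* `unprojectedDense_of_ecCell_succ`, `ecCell_of_ecCell_succ` — **rung monotonicity**:
  `ECCell (n+1) (d+1)` implies Zariski DENSITY of exponential points (`I(W ∩ Γ_exp) = I(W)`) for
  every `W` with the binders of `ECCell n d`, in particular `ECCell n d` itself;
* `unprojectedDense_of_isExpAlgClosed_of_binders` — **EAC ⇒ density** (Aslanyan–Gallinaro Rem. 3.5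
  as a theorem);
* `unprojectedDense_of_ecCellPeriodicStdFib`, `ecCell_of_ecCellPeriodicStdFib` — the FIBRED PERIODIC
  piece `ECCellPeriodicStdFib (k+1)` of `EC(k+2, k+1)` already implies density in, and hence the
  whole of, the cell `EC(k+1, k)` (the lift has base period `e_last` and lies in the fibred piece);
* `ecCellPeriodicStdFib_two_iff_mmDensityFree` — **THE EQUIVALENCE** for the first open rung:
  `ECCellPeriodicStdFib 2 ↔ ∀ S, MMCaseDimPiOneFree S → IsMulFree ℂ 2 (S ∩ G²) → UnprojectedDense S`
  (`←` is gen 5's fibration principle `inter_expGraph_nonempty_of_unprojectedDense_proj` with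
  `mmCaseDimPiOneFree_projClosure` and seat 1's `isMulFree_projClosure_inter_torusLocus`; `→` is the
  lift, a surface of Mantova–Masser's case (dim-π-S-1-free) having rotund and additively free torus
  part because its base curve is aperiodic).  Mantova–Masser: "in our situation the analogous
  statement is unclear, even for `n = 2`" — it is exactly the fibred periodic piece of their
  "simplest case of dimension 2 in `ℂ³ × ℂ^{*3}`"; also `ECCell 3 2 → ECCell 2 1`.

HONEST FRAMING: implications and an equivalence between OPEN statements (plus a remark from the
literature made rigorous); no case of EAC is proved; `EC(3,2)` OPEN; nothing here bears on
Schanuel's conjecture (EAC does not imply SC); no statement of Mantova–Masser is used as a hypothesis.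
-/

noncomputable section

open MvPolynomial
open Literature.NumberTheory.Transcendental Literature.ModelTheory.Zilber
open Literature.ModelTheory.ExponentialFields

set_option linter.dupNamespace false

namespace Summit.Schanuel.Schanuel.Theorems

variable {n d : ℕ}

/-! ## The lift raises the cell by one -/

/-- **The density lift raises the cell by one**: if `W ⊆ ℂⁿ × ℂⁿ` has the binders of `ECCell n d`
and `e ∉ I(W)`, then `W_e(W) ⊆ ℂ^{n+1} × ℂ^{n+1}` has the binders of `ECCell (n+1) (d+1)`.
[cite: AslanyanGallinaro2024, Rem. 3.5 (p. 12)] -/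
theorem ecCell_binders_liftVar {W : Set (Fin n ⊕ Fin n → ℂ)} (hW : IsIrreducibleClosed ℂ W)
    (hne : (W ∩ torusLocus ℂ n).Nonempty) (hrot : IsRotund ℂ n (W ∩ torusLocus ℂ n))
    (hadd : IsAddFree ℂ n (W ∩ torusLocus ℂ n)) (hmul : IsMulFree ℂ n (W ∩ torusLocus ℂ n))
    (hdim : zariskiDim ℂ W = n) (hapd : addProjDim ℂ n W = d)
    (e : MvPolynomial (Fin n ⊕ Fin n) ℂ) (he : e ∉ vanishingIdeal ℂ W) :
    IsIrreducibleClosed ℂ (liftVar e W) ∧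
      (liftVar e W ∩ torusLocus ℂ (n + 1)).Nonempty ∧
      IsRotund ℂ (n + 1) (liftVar e W ∩ torusLocus ℂ (n + 1)) ∧
      IsAddFree ℂ (n + 1) (liftVar e W ∩ torusLocus ℂ (n + 1)) ∧
      IsMulFree ℂ (n + 1) (liftVar e W ∩ torusLocus ℂ (n + 1)) ∧
      zariskiDim ℂ (liftVar e W) = (n + 1 : ℕ) ∧
      addProjDim ℂ (n + 1) (liftVar e W) = (d + 1 : ℕ) := by
  refine ⟨isIrreducibleClosed_liftVar e hW, liftVar_inter_torusLocus_nonempty e hW.2 hne he,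
    isRotund_liftVar_of_isRotund e hW hne he hrot, isAddFree_liftVar e hW hne he hadd,
    isMulFree_liftVar e hW hne he hmul, ?_, ?_⟩
  · rw [zariskiDim_liftVar, hdim]
    norm_cast
  · rw [addProjDim_liftVar e hW hne he, hapd]
    norm_cast

/-- An exponential point of the lift `W_e(W)` is (over) an exponential point of `W` at which `e ≠ 0`
(`x · e(s) = e^x ≠ 0`). [folklore] -/
theorem exists_eval_ne_zero_of_mem_liftVar_inter_expGraph {W : Set (Fin n ⊕ Fin n → ℂ)}
    {e : MvPolynomial (Fin n ⊕ Fin n) ℂ} {w : Fin (n + 1) ⊕ Fin (n + 1) → ℂ}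
    (hw : w ∈ liftVar e W ∩ expGraph ℂ (n + 1)) :
    ∃ s ∈ W ∩ expGraph ℂ n, MvPolynomial.eval s e ≠ 0 := by
  obtain ⟨hwW, hwΓ⟩ := hw
  obtain ⟨s, hs, x, rfl⟩ := (mem_liftVar_iff e).1 hwW
  rw [mem_expGraph_iff] at hwΓ
  refine ⟨s, ⟨hs, ?_⟩, ?_⟩
  · rw [mem_expGraph_iff]
    intro i
    have := hwΓ (Fin.castSucc i)
    rwa [liftPt_inr_castSucc, liftPt_inl_castSucc] at this
  · intro hes
    have := hwΓ (Fin.last n)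
    rw [liftPt_inr_last, liftPt_inl_last, hes, mul_zero] at this
    exact (ExponentialRing.isUnit_exp x).ne_zero this.symm

/-- Exponential points off every hypersurface section are Zariski dense. [folklore] -/
theorem unprojectedDense_of_forall_exists {W : Set (Fin n ⊕ Fin n → ℂ)}
    (h : ∀ e : MvPolynomial (Fin n ⊕ Fin n) ℂ, e ∉ vanishingIdeal ℂ W →
      ∃ s ∈ W ∩ expGraph ℂ n, MvPolynomial.eval s e ≠ 0) :
    UnprojectedDense W := by
  refine le_antisymm ?_ (vanishingIdeal_anti_mono Set.inter_subset_left)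
  intro G hG
  by_contra hGW
  obtain ⟨s, hs, hGs⟩ := h G hGW
  exact hGs ((mem_vanishingIdeal_iff.1 hG) s hs)

/-- Zariski-dense exponential points on an irreducible `W` give at least one. [folklore] -/
theorem nonempty_inter_expGraph_of_unprojectedDense {W : Set (Fin n ⊕ Fin n → ℂ)}
    (hW : IsIrreducibleClosed ℂ W) (hd : UnprojectedDense W) : (W ∩ expGraph ℂ n).Nonempty := by
  by_contra h
  rw [Set.not_nonempty_iff_eq_empty] at h
  have h' := hd
  unfold UnprojectedDense at h'
  rw [h, vanishingIdeal_empty] at h'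
  exact hW.2.ne_top h'.symm

/-! ## One rung up gives density; rung monotonicity; EAC ⇒ density -/

/-- **One rung up gives density**: `ECCell (n+1) (d+1)` implies that every `W` with the binders of
`ECCell n d` has Zariski-dense exponential points, `I(W ∩ Γ_exp) = I(W)`.
[cite: AslanyanGallinaro2024, Rem. 3.5 (p. 12)] -/
theorem unprojectedDense_of_ecCell_succ (h : ECCell (n + 1) (d + 1))
    {W : Set (Fin n ⊕ Fin n → ℂ)} (hW : IsIrreducibleClosed ℂ W)
    (hne : (W ∩ torusLocus ℂ n).Nonempty) (hrot : IsRotund ℂ n (W ∩ torusLocus ℂ n))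
    (hadd : IsAddFree ℂ n (W ∩ torusLocus ℂ n)) (hmul : IsMulFree ℂ n (W ∩ torusLocus ℂ n))
    (hdim : zariskiDim ℂ W = n) (hapd : addProjDim ℂ n W = d) : UnprojectedDense W := by
  refine unprojectedDense_of_forall_exists fun e he => ?_
  obtain ⟨h1, h2, h3, h4, h5, h6, h7⟩ := ecCell_binders_liftVar hW hne hrot hadd hmul hdim hapd e he
  obtain ⟨w, hw⟩ := h (liftVar e W) h1 h2 h3 h4 h5 h6 h7
  exact exists_eval_ne_zero_of_mem_liftVar_inter_expGraph hw

/-- **Rung monotonicity of the EAC ladder**: `ECCell (n+1) (d+1) → ECCell n d`.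
[cite: AslanyanGallinaro2024, Rem. 3.5 (p. 12)] -/
theorem ecCell_of_ecCell_succ (h : ECCell (n + 1) (d + 1)) : ECCell n d :=
  fun _ hW hne hrot hadd hmul hdim hapd =>
    nonempty_inter_expGraph_of_unprojectedDense hW
      (unprojectedDense_of_ecCell_succ h hW hne hrot hadd hmul hdim hapd)

/-- **Exponential Closedness implies Zariski density of exponential points** (Aslanyan–Gallinaro
2024, Remark 3.5, made rigorous by the twisted lift): if `ℂ_exp` is exponentially-algebraically
closed, then every irreducible `W ⊆ ℂⁿ × ℂⁿ` of dimension `n` meeting `Gⁿ` whose torus part is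
rotund, additively free and multiplicatively free satisfies `I(W ∩ Γ_exp) = I(W)`.
[cite: AslanyanGallinaro2024, Rem. 3.5 (p. 12)] -/
theorem unprojectedDense_of_isExpAlgClosed_of_binders (h : IsExpAlgClosed ℂ)
    {W : Set (Fin n ⊕ Fin n → ℂ)} (hW : IsIrreducibleClosed ℂ W)
    (hne : (W ∩ torusLocus ℂ n).Nonempty) (hrot : IsRotund ℂ n (W ∩ torusLocus ℂ n))
    (hadd : IsAddFree ℂ n (W ∩ torusLocus ℂ n)) (hmul : IsMulFree ℂ n (W ∩ torusLocus ℂ n))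
    (hdim : zariskiDim ℂ W = n) : UnprojectedDense W := by
  obtain ⟨z, hz⟩ := hne
  obtain ⟨d, -, hd⟩ := exists_nat_zariskiDim_eq (K := ℂ)
    (S := projAdd '' (W ∩ torusLocus ℂ n)) ⟨_, ⟨z, hz, rfl⟩⟩
  exact unprojectedDense_of_ecCell_succ (isExpAlgClosed_complex_iff_forall_ecCell.1 h (n + 1) (d + 1))
    hW ⟨z, hz⟩ hrot hadd hmul hdim hd

/-- **Rung monotonicity, iterated**: `ECCell (n+j) (d+j) → ECCell n d`. [folklore] -/
theorem ecCell_of_ecCell_add (j : ℕ) (h : ECCell (n + j) (d + j)) : ECCell n d := by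
  induction j with
  | zero => simpa using h
  | succ j ih => exact ih (ecCell_of_ecCell_succ (n := n + j) (d := d + j) h)

/-- **EAC is decided in high dimension**: for every `N`, `IsExpAlgClosed ℂ ↔ ∀ n ≥ N, ∀ d, ECCell n d`
(cells below level `N` follow from cells at level `≥ N` by rung monotonicity). [folklore] -/
theorem isExpAlgClosed_complex_iff_forall_le (N : ℕ) :
    IsExpAlgClosed ℂ ↔ ∀ n, N ≤ n → ∀ d, ECCell n d := by
  rw [isExpAlgClosed_complex_iff_forall_ecCell]
  refine ⟨fun h n _ d => h n d, fun h n d => ?_⟩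
  by_cases hn : N ≤ n
  · exact h n hn d
  · exact ecCell_of_ecCell_add (N - n) (h (n + (N - n)) (by omega) (d + (N - n)))

/-- **EAC ⟺ its density form**: `ℂ_exp` is exponentially-algebraically closed iff every irreducible
`W ⊆ ℂⁿ × ℂⁿ` of dimension `n` meeting `Gⁿ` with rotund, additively free and multiplicatively free torus
part has Zariski-dense exponential points. [cite: AslanyanGallinaro2024, Rem. 3.5 (p. 12)] -/
theorem isExpAlgClosed_complex_iff_unprojectedDense :
    IsExpAlgClosed ℂ ↔ ∀ (n : ℕ) (W : Set (Fin n ⊕ Fin n → ℂ)), IsIrreducibleClosed ℂ W →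
      (W ∩ torusLocus ℂ n).Nonempty → IsRotund ℂ n (W ∩ torusLocus ℂ n) →
      IsAddFree ℂ n (W ∩ torusLocus ℂ n) → IsMulFree ℂ n (W ∩ torusLocus ℂ n) →
      zariskiDim ℂ W = n → UnprojectedDense W := by
  constructor
  · intro h n W hW hne hrot hadd hmul hdim
    exact unprojectedDense_of_isExpAlgClosed_of_binders h hW hne hrot hadd hmul hdim
  · intro h
    rw [isExpAlgClosed_complex_iff_forall_ecCell]
    intro n d W hW hne hrot hadd hmul hdim _
    exact nonempty_inter_expGraph_of_unprojectedDense hW (h n W hW hne hrot hadd hmul hdim)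

/-! ## The fibred periodic piece one rung up gives density -/

/-- **`ECCellPeriodicStdFib (k+1)` gives density in the cell `(k+1, k)`**: the lift `W_e(W)` of a
member `W` of the cell `(k+1, k)` has base period `e_last` (`isPeriodVec_projAdd_liftVar`) and fibre
dimension `dim W` (`zariskiDim_image_dropLastMat_liftVar`), so it lies in the fibred periodic piece.
[cite: MantovaMasser2023, §1 Further remarks, p. 5] -/
theorem unprojectedDense_of_ecCellPeriodicStdFib {k : ℕ} (h : ECCellPeriodicStdFib (k + 1))
    {W : Set (Fin (k + 1) ⊕ Fin (k + 1) → ℂ)} (hW : IsIrreducibleClosed ℂ W)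
    (hne : (W ∩ torusLocus ℂ (k + 1)).Nonempty) (hrot : IsRotund ℂ (k + 1) (W ∩ torusLocus ℂ (k + 1)))
    (hadd : IsAddFree ℂ (k + 1) (W ∩ torusLocus ℂ (k + 1)))
    (hmul : IsMulFree ℂ (k + 1) (W ∩ torusLocus ℂ (k + 1)))
    (hdim : zariskiDim ℂ W = (k + 1 : ℕ)) (hapd : addProjDim ℂ (k + 1) W = k) :
    UnprojectedDense W := by
  refine unprojectedDense_of_forall_exists fun e he => ?_
  obtain ⟨h1, h2, h3, h4, h5, h6, h7⟩ := ecCell_binders_liftVar hW hne hrot hadd hmul hdim hapd e he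
  have h8 := isPeriodVec_projAdd_liftVar (S := W) e
  have h9 : zariskiDim ℂ (matrixAct (dropLastMat (k + 1)) ''
      (liftVar e W ∩ torusLocus ℂ (k + 1 + 1))) = (k + 1 : ℕ) := by
    rw [zariskiDim_image_dropLastMat_liftVar e hW hne he, hdim]
  obtain ⟨w, hw⟩ := h (liftVar e W) h1 h2 h3 h4 h5 h6 h7 h8 h9
  exact exists_eval_ne_zero_of_mem_liftVar_inter_expGraph hw

/-- **The fibred periodic piece of `EC(k+2, k+1)` implies the cell `EC(k+1, k)`.**
[cite: MantovaMasser2023, §1 Further remarks, p. 5] -/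
theorem ecCell_of_ecCellPeriodicStdFib {k : ℕ} (h : ECCellPeriodicStdFib (k + 1)) :
    ECCell (k + 1) k :=
  fun _ hW hne hrot hadd hmul hdim hapd =>
    nonempty_inter_expGraph_of_unprojectedDense hW
      (unprojectedDense_of_ecCellPeriodicStdFib h hW hne hrot hadd hmul hdim hapd)

/-- **Monotonicity of the fibred periodic pieces**: `ECCellPeriodicStdFib (k+2) → ECCellPeriodicStdFib (k+1)`
(through the whole cell `EC(k+2, k+1)` and seat 1's splitting of a cell into its sub-pieces). [folklore] -/
theorem ecCellPeriodicStdFib_of_succ {k : ℕ} (h : ECCellPeriodicStdFib (k + 2)) :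
    ECCellPeriodicStdFib (k + 1) :=
  (ecCellPeriodicStd_iff_fib_and_dom.1 (ecCellPeriodic_iff_std.1
    ((ecCell_succ_iff (k + 1)).1 (ecCell_of_ecCellPeriodicStdFib (k := k + 1) h)).2)).1

/-! ## The first open rung: `Fib(3,2)` is Mantova–Masser's free density question -/

/-- A surface of Mantova–Masser's case (dim-π-S-1-free) has aperiodic base curve (not a line of
rational slope). [cite: MantovaMasser2023, Thm. 1.2 case (dim-pi-S-1-free)] -/
theorem not_hasIntegerPeriod_of_mmCaseDimPiOneFree {S : Set (Fin 2 ⊕ Fin 2 → ℂ)}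
    (hS : MMCaseDimPiOneFree S) : ¬ HasIntegerPeriod ℂ (projAdd '' (S ∩ torusLocus ℂ 2)) :=
  fun hp => hS.2.2.2.2 ((hasIntegerPeriod_projAdd_iff_isRationalSlopeLine hS.1 hS.2.1 hS.2.2.2.1).1 hp)

/-- Hence its torus part is additively free (`isAddFree_of_not_hasIntegerPeriod`). [folklore] -/
theorem isAddFree_of_mmCaseDimPiOneFree {S : Set (Fin 2 ⊕ Fin 2 → ℂ)} (hS : MMCaseDimPiOneFree S) :
    IsAddFree ℂ 2 (S ∩ torusLocus ℂ 2) :=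
  isAddFree_of_not_hasIntegerPeriod (d := 1) hS.1 hS.2.1 one_pos hS.2.2.2.1
    (not_hasIntegerPeriod_of_mmCaseDimPiOneFree hS)

/-- And rotund (`isRotund_of_not_hasIntegerPeriod`, seat 1). [folklore] -/
theorem isRotund_of_mmCaseDimPiOneFree {S : Set (Fin 2 ⊕ Fin 2 → ℂ)} (hS : MMCaseDimPiOneFree S) :
    IsRotund ℂ 2 (S ∩ torusLocus ℂ 2) :=
  isRotund_of_not_hasIntegerPeriod (d := 1) hS.1 hS.2.1 hS.2.2.1 hS.2.2.2.1
    (not_hasIntegerPeriod_of_mmCaseDimPiOneFree hS)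

/-- **The fibred periodic piece of `EC(3,2)` implies Mantova–Masser's free density question**:
if `ECCellPeriodicStdFib 2`, then every surface `S ⊆ ℂ² × ℂ²` of case (dim-π-S-1-free) whose torus
part is multiplicatively free has Zariski-dense exponential points, `I(S ∩ Γ_exp) = I(S)`.
[cite: MantovaMasser2023, §1 Further remarks, p. 5] -/
theorem unprojectedDense_of_ecCellPeriodicStdFib_two (h : ECCellPeriodicStdFib 2)
    {S : Set (Fin 2 ⊕ Fin 2 → ℂ)} (hS : MMCaseDimPiOneFree S)
    (hmul : IsMulFree ℂ 2 (S ∩ torusLocus ℂ 2)) : UnprojectedDense S :=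
  unprojectedDense_of_ecCellPeriodicStdFib (k := 1) h hS.1 hS.2.1 (isRotund_of_mmCaseDimPiOneFree hS)
    (isAddFree_of_mmCaseDimPiOneFree hS) hmul hS.2.2.1 hS.2.2.2.1

/-- **THE EQUIVALENCE.**  The fibred periodic piece `ECCellPeriodicStdFib 2` of the first open cell
`EC(3,2)` of Zilber's Exponential-Algebraic Closedness holds if and only if every surface
`S ⊆ ℂ² × ℂ²` of Mantova–Masser's case (dim-π-S-1-free) with multiplicatively free torus part has
Zariski-dense exponential points (Mantova–Masser's §1 question, in the free form forced by seat 1's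
resonant parabola `not_forall_mmCaseDimPiOneFree_unprojectedDense`).  `←`: gen 5's fibration
principle; `→`: the density lift.  Both sides OPEN. [cite: MantovaMasser2023, §1 Further remarks, p. 5] -/
theorem ecCellPeriodicStdFib_two_iff_mmDensityFree :
    ECCellPeriodicStdFib 2 ↔
      ∀ S : Set (Fin 2 ⊕ Fin 2 → ℂ), MMCaseDimPiOneFree S →
        IsMulFree ℂ 2 (S ∩ torusLocus ℂ 2) → UnprojectedDense S := by
  constructor
  · intro h S hS hmul
    exact unprojectedDense_of_ecCellPeriodicStdFib_two (S := S) h hS hmul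
  · intro h W hW hne _ hadd hmul hdim hbase hper hfib
    exact inter_expGraph_nonempty_of_unprojectedDense_proj hW hne hdim hfib
      (h _ (mmCaseDimPiOneFree_projClosure hW hne hadd hbase hper hfib)
        (isMulFree_projClosure_inter_torusLocus hmul))

/-- **`Fib(3,2) ⇒ EC(2,1)`** (the case `k = 1` of `ecCell_of_ecCellPeriodicStdFib`; equivalently
seat 1's `ecCell_two_one_of_mmDensityFree` after `unprojectedDense_of_ecCellPeriodicStdFib_two`).
[cite: MantovaMasser2023, Thm. 1.1] -/
theorem ecCell_two_one_of_ecCellPeriodicStdFib_two (h : ECCellPeriodicStdFib 2) : ECCell 2 1 :=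
  ecCell_of_ecCellPeriodicStdFib (k := 1) h

/-- **The first open rung implies Mantova–Masser's free density question** (`ECCell 3 2` contains
its fibred periodic piece, `ecCell_three_two_iff_three`). [cite: MantovaMasser2023, §1 Further remarks, p. 5] -/
theorem unprojectedDense_of_ecCell_three_two (h : ECCell 3 2)
    {S : Set (Fin 2 ⊕ Fin 2 → ℂ)} (hS : MMCaseDimPiOneFree S)
    (hmul : IsMulFree ℂ 2 (S ∩ torusLocus ℂ 2)) : UnprojectedDense S :=
  unprojectedDense_of_ecCellPeriodicStdFib_two (ecCell_three_two_iff_three.1 h).2.1 hS hmul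

/-- **`EC(3,2) ⇒ EC(2,1)`** (the case `n = 2, d = 1` of `ecCell_of_ecCell_succ`). [folklore] -/
theorem ecCell_two_one_of_ecCell_three_two (h : ECCell 3 2) : ECCell 2 1 :=
  ecCell_of_ecCell_succ (n := 2) (d := 1) h

/-- **EAC implies the free density question of Mantova–Masser** (surfaces of case (dim-π-S-1-free)
with multiplicatively free torus part). [cite: MantovaMasser2023, §1 Further remarks, p. 5] -/
theorem unprojectedDense_of_isExpAlgClosed (h : IsExpAlgClosed ℂ)
    {S : Set (Fin 2 ⊕ Fin 2 → ℂ)} (hS : MMCaseDimPiOneFree S)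
    (hmul : IsMulFree ℂ 2 (S ∩ torusLocus ℂ 2)) : UnprojectedDense S :=
  unprojectedDense_of_ecCell_three_two (isExpAlgClosed_complex_iff_forall_ecCell.1 h 3 2) hS hmul

/-! ## The state of the first open rung -/

/-- **What `EC(3,2)` consists of, after the density lift.**  The first open rung of Zilber's
Exponential-Algebraic Closedness is equivalent to the conjunction of: (a) its APERIODIC half in the
four-hypothesis form of seat 1 (`ecCellAperiodic_two_iff_four`: irreducible `W ⊆ ℂ³ × ℂ³` of
dimension `3` with multiplicatively free torus part, `addProjDim = 2` and aperiodic base meet `Γ_exp`);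
(b) Mantova–Masser's density question in its free form (surfaces of case (dim-π-S-1-free) with
multiplicatively free torus part have Zariski-dense exponential points) — by
`ecCellPeriodicStdFib_two_iff_mmDensityFree` this IS the fibred periodic piece; (c) the co-dominant
periodic piece `ECCellPeriodicStdDom 2` (generic fibres of `W ∩ G³ → cl[Δ_2]` finite).  All three are
OPEN; (a), (b), (c) are pairwise distinct structural problems. [cite: MantovaMasser2023, §1 Further remarks, p. 5] -/
theorem ecCell_three_two_iff_aperiodic_density_dom :
    ECCell 3 2 ↔
      (∀ (W : Set (Fin 3 ⊕ Fin 3 → ℂ)), IsIrreducibleClosed ℂ W →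
        IsMulFree ℂ 3 (W ∩ torusLocus ℂ 3) → zariskiDim ℂ W = (3 : ℕ) →
        addProjDim ℂ 3 W = 2 → ¬ HasIntegerPeriod ℂ (projAdd '' (W ∩ torusLocus ℂ 3)) →
        (W ∩ expGraph ℂ 3).Nonempty) ∧
      (∀ S : Set (Fin 2 ⊕ Fin 2 → ℂ), MMCaseDimPiOneFree S →
        IsMulFree ℂ 2 (S ∩ torusLocus ℂ 2) → UnprojectedDense S) ∧
      ECCellPeriodicStdDom 2 := by
  rw [ecCell_three_two_iff_three, ecCellAperiodic_two_iff_four, ecCellPeriodicStdFib_two_iff_mmDensityFree]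

end Summit.Schanuel.Schanuel.Theorems
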